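import Mathlib.Data.Finset.Sort
import Summits.CriticalPhenomena.PercolationContinuityZ3.Theorems.PercNearOneGluingNoHeavyLowerTailKnQuestion8CoefficientwiseCoreClassKernelMixIETFlow
import HarnessLib

/-!
# Layer-cake reduction for the increasing-event transfer: real levels from 0/1 levels

Support file (`--supports stmt-CriticalPhenomena-4575`, closed), prover `prim-cplus-coupling` (gen 42).  No definitions, no notations,
no named facts, no sorries; standard axioms.  Memo `prim-cplus-coupling/A5-COUPLING-gen42.md` §5.

The IET form (gen 37–41; `Coefficientwise.iet_cycle`, `Coefficientwise.iet_deficit_bound`) at levels `h, k, hᵃ, hᵇ, kᵃ, kᵇ : Set V → ℝ` is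
  `Σ_{ω : supply} h(Xω) k(Xω) + Σ_{ω : demand} (hᵃ(Xω) − hᵇ(Yω)) (kᵃ(Xω) − kᵇ(Yω))`,
BILINEAR in the triples `(h, hᵃ, hᵇ)` and `(k, kᵃ, kᵇ)`.  Every admissible real triple (monotone, `0 ≤ hᵃ, hᵇ ≤ h`) is, on the finitely many
arguments that occur, a nonnegative combination `Σ_i c_i (θ_i, θᵃ_i, θᵇ_i)` of admissible 0/1 triples `θ_i = 1[s_i ≤ h]`, `θᵃ_i = 1[s_i ≤ hᵃ]`,
`θᵇ_i = 1[s_i ≤ hᵇ]` with the SAME thresholds `s_i` (discrete layer cake, `Coefficientwise.layerCake_finset`).  Hence: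
* `Coefficientwise.iet_of_indicator_levels` — if the form is `≥ 0` for all admissible 0/1 level systems then it is `≥ 0` for all
  admissible real level systems (abstract version: arbitrary index set `E`, arbitrary maps `X, Y`, arbitrary supply / demand predicates);
* `Coefficientwise.iet_graph_of_indicator_levels` — the same in the cluster notation of the IET files (`X = C_u ω`, `Y = C_u(E∖ω)`,
  supply `b ∈ X∖Y`, demand `b ∈ Y∖X`, restricted to an event `𝒱`).
This is the reduction 'IET ⟺ its 0/1 counting form `#S(𝒱) + #P₁(𝒱) + #P₂(𝒱) ≥ #bad₁(𝒱) + #bad₂(𝒱)`' used throughout the memos (gen 39 §4.1,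
gen 41 header), now available to turn counting proofs (Hall / injections on 0/1 levels) into real-level theorems.
-/

namespace Summit.CriticalPhenomena.PercolationContinuityZ3.Theorems

open Finset Literature.Probability.Percolation

namespace Coefficientwise

/-- **Discrete layer cake on a finite value set.**  For a finite set `T ⊆ [0, ∞)` of reals containing `0` there are finitely many
thresholds `s i` and nonnegative weights `c i` (`i < n`) with `v = Σ_{i<n} c_i · 1[s_i ≤ v]` for every `v ∈ T`
(sort `T = {t₀ = 0 < t₁ < ⋯}`, `s_i = t_{i+1}`, `c_i = t_{i+1} − t_i`, telescoping). [folklore] -/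
theorem layerCake_finset (T : Finset ℝ) (hT0 : (0 : ℝ) ∈ T) (hTpos : ∀ v ∈ T, 0 ≤ v) :
    ∃ (n : ℕ) (s c : ℕ → ℝ), (∀ i, i < n → 0 ≤ c i) ∧
      ∀ v ∈ T, v = ∑ i ∈ Finset.range n, c i * (if s i ≤ v then 1 else 0) := by
  classical
  set N := T.card with hN
  have hNpos : 0 < N := Finset.card_pos.mpr ⟨0, hT0⟩
  set emb := T.orderEmbOfFin hN.symm with hemb
  -- thresholds as a function on ℕ
  set t : ℕ → ℝ := fun i => if hi : i < N then emb ⟨i, hi⟩ else 0 with ht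
  have ht_of_lt : ∀ i (hi : i < N), t i = emb ⟨i, hi⟩ := by
    intro i hi; simp only [ht, dif_pos hi]
  have hsm : ∀ i j (hi : i < N) (hj : j < N), (t i ≤ t j ↔ i ≤ j) := by
    intro i j hi hj
    rw [ht_of_lt i hi, ht_of_lt j hj]
    constructor
    · intro hle
      by_contra hlt
      have hlt' : j < i := Nat.lt_of_not_le hlt
      have : emb ⟨j, hj⟩ < emb ⟨i, hi⟩ := emb.strictMono (Fin.mk_lt_mk.mpr hlt')
      linarith
    · intro hle
      exact emb.monotone (Fin.mk_le_mk.mpr hle)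
  have ht0 : t 0 = 0 := by
    rw [ht_of_lt 0 hNpos]
    have hz : emb ⟨0, hNpos⟩ = T.min' ⟨0, hT0⟩ := by
      rw [hemb]; exact Finset.orderEmbOfFin_zero hN.symm hNpos
    rw [hz]
    apply le_antisymm
    · exact Finset.min'_le T 0 hT0
    · exact hTpos _ (Finset.min'_mem T _)
  have hsurj : ∀ v ∈ T, ∃ J, J < N ∧ t J = v := by
    intro v hv
    have : v ∈ Set.range emb := by
      rw [hemb, Finset.range_orderEmbOfFin]; exact hv
    obtain ⟨⟨J, hJ⟩, hJv⟩ := this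
    exact ⟨J, hJ, by rw [ht_of_lt J hJ]; exact hJv⟩
  refine ⟨N - 1, fun i => t (i + 1), fun i => t (i + 1) - t i, ?_, ?_⟩
  · intro i hi
    have h1 : i < N := by omega
    have h2 : i + 1 < N := by omega
    have := (hsm i (i + 1) h1 h2).mpr (by omega)
    linarith
  · intro v hv
    obtain ⟨J, hJN, hJv⟩ := hsurj v hv
    -- the indicator is `[i + 1 ≤ J]`
    have hind : ∀ i ∈ Finset.range (N - 1),
        (t (i + 1) - t i) * (if t (i + 1) ≤ v then (1 : ℝ) else 0) = if i < J then t (i + 1) - t i else 0 := by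
      intro i hi
      have hi' : i + 1 < N := by have := Finset.mem_range.mp hi; omega
      rw [← hJv]
      by_cases hiJ : i < J
      · have hle : t (i + 1) ≤ t J := (hsm (i + 1) J hi' hJN).mpr (by omega)
        rw [if_pos hle, if_pos hiJ, mul_one]
      · have hnle : ¬ t (i + 1) ≤ t J := by
          intro hle; exact hiJ (by have := (hsm (i + 1) J hi' hJN).mp hle; omega)
        rw [if_neg hnle, if_neg hiJ, mul_zero]
    rw [Finset.sum_congr rfl hind]
    have hJle : J ≤ N - 1 := by omega
    rw [← Finset.sum_range_add_sum_Ico _ hJle]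
    have hIco : ∑ i ∈ Finset.Ico J (N - 1), (if i < J then t (i + 1) - t i else 0) = 0 := by
      apply Finset.sum_eq_zero
      intro i hi
      rw [Finset.mem_Ico] at hi
      rw [if_neg (by omega)]
    rw [hIco, add_zero]
    have hrange : ∑ i ∈ Finset.range J, (if i < J then t (i + 1) - t i else 0) = ∑ i ∈ Finset.range J, (t (i + 1) - t i) := by
      apply Finset.sum_congr rfl
      intro i hi
      rw [if_pos (Finset.mem_range.mp hi)]
    rw [hrange, Finset.sum_range_sub, ht0, sub_zero, hJv]

/-- **IET: real levels from 0/1 levels (abstract form).**  Let `E` be a finite index set, `X, Y : Finset ι → Set V` arbitrary maps and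
`RD, DD` arbitrary ('supply' / 'demand') predicates.  If
  `0 ≤ Σ_{ω ⊆ E, RD ω} h(Xω)k(Xω) + Σ_{ω ⊆ E, DD ω} (hᵃ(Xω) − hᵇ(Yω))(kᵃ(Xω) − kᵇ(Yω))`
holds for all MONOTONE level systems with VALUES IN `{0,1}` and `hᵃ, hᵇ ≤ h`, `kᵃ, kᵇ ≤ k`, then it holds for all monotone real level
systems with `0 ≤ hᵃ, hᵇ ≤ h`, `0 ≤ kᵃ, kᵇ ≤ k`.  Proof: discrete layer cake (`layerCake_finset`) for each side on the finite set of values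
taken on the arguments `X ω, Y ω`, with common thresholds for `h, hᵃ, hᵇ` (resp. `k, kᵃ, kᵇ`), and bilinearity of the form. [folklore] -/
theorem iet_of_indicator_levels {ι V : Type*} [DecidableEq ι] (E : Finset ι) (RD DD : Finset ι → Prop) [DecidablePred RD] [DecidablePred DD]
    (X Y : Finset ι → Set V)
    (H01 : ∀ (h k ha hb ka kb : Set V → ℝ), Monotone h → Monotone k → Monotone ha → Monotone hb → Monotone ka → Monotone kb →
      (∀ S, h S = 0 ∨ h S = 1) → (∀ S, k S = 0 ∨ k S = 1) → (∀ S, ha S = 0 ∨ ha S = 1) → (∀ S, hb S = 0 ∨ hb S = 1) →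
      (∀ S, ka S = 0 ∨ ka S = 1) → (∀ S, kb S = 0 ∨ kb S = 1) →
      (∀ S, ha S ≤ h S) → (∀ S, hb S ≤ h S) → (∀ S, ka S ≤ k S) → (∀ S, kb S ≤ k S) →
      0 ≤ (∑ ω ∈ E.powerset, if RD ω then h (X ω) * k (X ω) else 0)
          + ∑ ω ∈ E.powerset, if DD ω then (ha (X ω) - hb (Y ω)) * (ka (X ω) - kb (Y ω)) else 0)
    (h k ha hb ka kb : Set V → ℝ) (mh : Monotone h) (mk : Monotone k)
    (mha : Monotone ha) (mhb : Monotone hb) (mka : Monotone ka) (mkb : Monotone kb)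
    (ha0 : ∀ S, 0 ≤ ha S) (hah : ∀ S, ha S ≤ h S) (hb0 : ∀ S, 0 ≤ hb S) (hbh : ∀ S, hb S ≤ h S)
    (ka0 : ∀ S, 0 ≤ ka S) (kak : ∀ S, ka S ≤ k S) (kb0 : ∀ S, 0 ≤ kb S) (kbk : ∀ S, kb S ≤ k S) :
    0 ≤ (∑ ω ∈ E.powerset, if RD ω then h (X ω) * k (X ω) else 0)
        + ∑ ω ∈ E.powerset, if DD ω then (ha (X ω) - hb (Y ω)) * (ka (X ω) - kb (Y ω)) else 0 := by
  classical
  -- the finite set of arguments and of values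
  set A : Finset (Set V) := E.powerset.image X ∪ E.powerset.image Y with hA
  have hXA : ∀ ω ∈ E.powerset, X ω ∈ A := fun ω hω => Finset.mem_union_left _ (Finset.mem_image_of_mem X hω)
  have hYA : ∀ ω ∈ E.powerset, Y ω ∈ A := fun ω hω => Finset.mem_union_right _ (Finset.mem_image_of_mem Y hω)
  set Th : Finset ℝ := insert 0 (A.image h ∪ A.image ha ∪ A.image hb) with hTh
  set Tk : Finset ℝ := insert 0 (A.image k ∪ A.image ka ∪ A.image kb) with hTk
  have h0 : ∀ S, 0 ≤ h S := fun S => le_trans (ha0 S) (hah S)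
  have k0 : ∀ S, 0 ≤ k S := fun S => le_trans (ka0 S) (kak S)
  have hThpos : ∀ v ∈ Th, 0 ≤ v := by
    intro v hv
    rw [hTh, Finset.mem_insert, Finset.mem_union, Finset.mem_union] at hv
    rcases hv with rfl | ((hv | hv) | hv)
    · exact le_refl _
    · obtain ⟨S, _, rfl⟩ := Finset.mem_image.mp hv; exact h0 S
    · obtain ⟨S, _, rfl⟩ := Finset.mem_image.mp hv; exact ha0 S
    · obtain ⟨S, _, rfl⟩ := Finset.mem_image.mp hv; exact hb0 S
  have hTkpos : ∀ v ∈ Tk, 0 ≤ v := by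
    intro v hv
    rw [hTk, Finset.mem_insert, Finset.mem_union, Finset.mem_union] at hv
    rcases hv with rfl | ((hv | hv) | hv)
    · exact le_refl _
    · obtain ⟨S, _, rfl⟩ := Finset.mem_image.mp hv; exact k0 S
    · obtain ⟨S, _, rfl⟩ := Finset.mem_image.mp hv; exact ka0 S
    · obtain ⟨S, _, rfl⟩ := Finset.mem_image.mp hv; exact kb0 S
  have hTh0 : (0 : ℝ) ∈ Th := by rw [hTh]; exact Finset.mem_insert_self _ _
  have hTk0 : (0 : ℝ) ∈ Tk := by rw [hTk]; exact Finset.mem_insert_self _ _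
  obtain ⟨n, s, c, hc, hdec⟩ := layerCake_finset Th hTh0 hThpos
  obtain ⟨n', s', c', hc', hdec'⟩ := layerCake_finset Tk hTk0 hTkpos
  -- membership of the values
  have memh : ∀ S ∈ A, h S ∈ Th := fun S hS => by
    rw [hTh]; exact Finset.mem_insert_of_mem (Finset.mem_union_left _ (Finset.mem_union_left _ (Finset.mem_image_of_mem h hS)))
  have memha : ∀ S ∈ A, ha S ∈ Th := fun S hS => by
    rw [hTh]; exact Finset.mem_insert_of_mem (Finset.mem_union_left _ (Finset.mem_union_right _ (Finset.mem_image_of_mem ha hS)))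
  have memhb : ∀ S ∈ A, hb S ∈ Th := fun S hS => by
    rw [hTh]; exact Finset.mem_insert_of_mem (Finset.mem_union_right _ (Finset.mem_image_of_mem hb hS))
  have memk : ∀ S ∈ A, k S ∈ Tk := fun S hS => by
    rw [hTk]; exact Finset.mem_insert_of_mem (Finset.mem_union_left _ (Finset.mem_union_left _ (Finset.mem_image_of_mem k hS)))
  have memka : ∀ S ∈ A, ka S ∈ Tk := fun S hS => by
    rw [hTk]; exact Finset.mem_insert_of_mem (Finset.mem_union_left _ (Finset.mem_union_right _ (Finset.mem_image_of_mem ka hS)))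
  have memkb : ∀ S ∈ A, kb S ∈ Tk := fun S hS => by
    rw [hTk]; exact Finset.mem_insert_of_mem (Finset.mem_union_right _ (Finset.mem_image_of_mem kb hS))
  -- the 0/1 level systems
  set θ : ℕ → Set V → ℝ := fun i S => if s i ≤ h S then 1 else 0 with hθ
  set θa : ℕ → Set V → ℝ := fun i S => if s i ≤ ha S then 1 else 0 with hθa
  set θb : ℕ → Set V → ℝ := fun i S => if s i ≤ hb S then 1 else 0 with hθb
  set φ : ℕ → Set V → ℝ := fun l S => if s' l ≤ k S then 1 else 0 with hφ
  set φa : ℕ → Set V → ℝ := fun l S => if s' l ≤ ka S then 1 else 0 with hφa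
  set φb : ℕ → Set V → ℝ := fun l S => if s' l ≤ kb S then 1 else 0 with hφb
  -- generic facts about threshold indicators
  have ind_mono : ∀ (f : Set V → ℝ) (r : ℝ), Monotone f → Monotone (fun S => if r ≤ f S then (1 : ℝ) else 0) := by
    intro f r mf S S' hSS'
    simp only
    by_cases h1 : r ≤ f S
    · rw [if_pos h1, if_pos (le_trans h1 (mf hSS'))]
    · rw [if_neg h1]; by_cases h2 : r ≤ f S'
      · rw [if_pos h2]; exact zero_le_one
      · rw [if_neg h2]
  have ind_01 : ∀ (f : Set V → ℝ) (r : ℝ) (S : Set V), (if r ≤ f S then (1 : ℝ) else 0) = 0 ∨ (if r ≤ f S then (1 : ℝ) else 0) = 1 := by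
    intro f r S; by_cases h1 : r ≤ f S
    · rw [if_pos h1]; exact Or.inr rfl
    · rw [if_neg h1]; exact Or.inl rfl
  have ind_le : ∀ (f g : Set V → ℝ) (r : ℝ), (∀ S, f S ≤ g S) → ∀ S, (if r ≤ f S then (1 : ℝ) else 0) ≤ (if r ≤ g S then (1 : ℝ) else 0) := by
    intro f g r hfg S; by_cases h1 : r ≤ f S
    · rw [if_pos h1, if_pos (le_trans h1 (hfg S))]
    · rw [if_neg h1]; by_cases h2 : r ≤ g S
      · rw [if_pos h2]; exact zero_le_one
      · rw [if_neg h2]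
  -- each elementary form is nonnegative
  have elem : ∀ i l, 0 ≤ (∑ ω ∈ E.powerset, if RD ω then θ i (X ω) * φ l (X ω) else 0)
      + ∑ ω ∈ E.powerset, if DD ω then (θa i (X ω) - θb i (Y ω)) * (φa l (X ω) - φb l (Y ω)) else 0 := by
    intro i l
    exact H01 (θ i) (φ l) (θa i) (θb i) (φa l) (φb l)
      (ind_mono h (s i) mh) (ind_mono k (s' l) mk) (ind_mono ha (s i) mha) (ind_mono hb (s i) mhb)
      (ind_mono ka (s' l) mka) (ind_mono kb (s' l) mkb)
      (fun S => ind_01 h (s i) S) (fun S => ind_01 k (s' l) S) (fun S => ind_01 ha (s i) S) (fun S => ind_01 hb (s i) S)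
      (fun S => ind_01 ka (s' l) S) (fun S => ind_01 kb (s' l) S)
      (ind_le ha h (s i) hah) (ind_le hb h (s i) hbh) (ind_le ka k (s' l) kak) (ind_le kb k (s' l) kbk)
  -- decompositions at the arguments that occur
  have dh : ∀ ω ∈ E.powerset, h (X ω) = ∑ i ∈ Finset.range n, c i * θ i (X ω) := fun ω hω => hdec _ (memh _ (hXA ω hω))
  have dha : ∀ ω ∈ E.powerset, ha (X ω) = ∑ i ∈ Finset.range n, c i * θa i (X ω) := fun ω hω => hdec _ (memha _ (hXA ω hω))
  have dhb : ∀ ω ∈ E.powerset, hb (Y ω) = ∑ i ∈ Finset.range n, c i * θb i (Y ω) := fun ω hω => hdec _ (memhb _ (hYA ω hω))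
  have dk : ∀ ω ∈ E.powerset, k (X ω) = ∑ l ∈ Finset.range n', c' l * φ l (X ω) := fun ω hω => hdec' _ (memk _ (hXA ω hω))
  have dka : ∀ ω ∈ E.powerset, ka (X ω) = ∑ l ∈ Finset.range n', c' l * φa l (X ω) := fun ω hω => hdec' _ (memka _ (hXA ω hω))
  have dkb : ∀ ω ∈ E.powerset, kb (Y ω) = ∑ l ∈ Finset.range n', c' l * φb l (Y ω) := fun ω hω => hdec' _ (memkb _ (hYA ω hω))
  -- expand the supply summands
  have keyR : ∀ ω ∈ E.powerset, (if RD ω then h (X ω) * k (X ω) else 0)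
      = ∑ i ∈ Finset.range n, ∑ l ∈ Finset.range n', c i * c' l * (if RD ω then θ i (X ω) * φ l (X ω) else 0) := by
    intro ω hω
    by_cases hR : RD ω
    · simp only [if_pos hR]
      rw [dh ω hω, dk ω hω, Finset.sum_mul_sum]
      apply Finset.sum_congr rfl; intro i _; apply Finset.sum_congr rfl; intro l _; ring
    · simp only [if_neg hR, mul_zero, Finset.sum_const_zero]
  -- expand the demand summands
  have keyD : ∀ ω ∈ E.powerset, (if DD ω then (ha (X ω) - hb (Y ω)) * (ka (X ω) - kb (Y ω)) else 0)
      = ∑ i ∈ Finset.range n, ∑ l ∈ Finset.range n', c i * c' l *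
          (if DD ω then (θa i (X ω) - θb i (Y ω)) * (φa l (X ω) - φb l (Y ω)) else 0) := by
    intro ω hω
    by_cases hD : DD ω
    · simp only [if_pos hD]
      have e1 : ha (X ω) - hb (Y ω) = ∑ i ∈ Finset.range n, c i * (θa i (X ω) - θb i (Y ω)) := by
        rw [dha ω hω, dhb ω hω, ← Finset.sum_sub_distrib]
        apply Finset.sum_congr rfl; intro i _; ring
      have e2 : ka (X ω) - kb (Y ω) = ∑ l ∈ Finset.range n', c' l * (φa l (X ω) - φb l (Y ω)) := by
        rw [dka ω hω, dkb ω hω, ← Finset.sum_sub_distrib]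
        apply Finset.sum_congr rfl; intro l _; ring
      rw [e1, e2, Finset.sum_mul_sum]
      apply Finset.sum_congr rfl; intro i _; apply Finset.sum_congr rfl; intro l _; ring
    · simp only [if_neg hD, mul_zero, Finset.sum_const_zero]
  rw [Finset.sum_congr rfl keyR, Finset.sum_congr rfl keyD]
  have eR : (∑ ω ∈ E.powerset, ∑ i ∈ Finset.range n, ∑ l ∈ Finset.range n', c i * c' l * (if RD ω then θ i (X ω) * φ l (X ω) else 0))
      = ∑ i ∈ Finset.range n, ∑ l ∈ Finset.range n', ∑ ω ∈ E.powerset, c i * c' l * (if RD ω then θ i (X ω) * φ l (X ω) else 0) := by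
    rw [Finset.sum_comm]; apply Finset.sum_congr rfl; intro i _; rw [Finset.sum_comm]
  have eD : (∑ ω ∈ E.powerset, ∑ i ∈ Finset.range n, ∑ l ∈ Finset.range n', c i * c' l *
          (if DD ω then (θa i (X ω) - θb i (Y ω)) * (φa l (X ω) - φb l (Y ω)) else 0))
      = ∑ i ∈ Finset.range n, ∑ l ∈ Finset.range n', ∑ ω ∈ E.powerset, c i * c' l *
          (if DD ω then (θa i (X ω) - θb i (Y ω)) * (φa l (X ω) - φb l (Y ω)) else 0) := by
    rw [Finset.sum_comm]; apply Finset.sum_congr rfl; intro i _; rw [Finset.sum_comm]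
  rw [eR, eD, ← Finset.sum_add_distrib]
  apply Finset.sum_nonneg
  intro i hi
  rw [← Finset.sum_add_distrib]
  apply Finset.sum_nonneg
  intro l hl
  rw [← Finset.mul_sum, ← Finset.mul_sum, ← mul_add]
  exact mul_nonneg (mul_nonneg (hc i (Finset.mem_range.mp hi)) (hc' l (Finset.mem_range.mp hl))) (elem i l)

open Classical in
/-- **IET: real levels from 0/1 levels (cluster form).**  For a finite multigraph (`ends`, `E`), root `u`, observer `b`, an event `𝒱`
(no closure hypothesis is needed for this reduction) and cluster notation `X = C_u ω`, `Y = C_u(E∖ω)`: if the IET sum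
`Σ_{𝒱, b∈X∖Y} h(X)k(X) + Σ_{𝒱, b∈Y∖X} (hᵃX − hᵇY)(kᵃX − kᵇY)` is nonnegative for all monotone `{0,1}`-valued level systems with
`hᵃ, hᵇ ≤ h`, `kᵃ, kᵇ ≤ k`, then it is nonnegative for all monotone real level systems with `0 ≤ hᵃ, hᵇ ≤ h`, `0 ≤ kᵃ, kᵇ ≤ k`
(the syntactic form of `iet_cycle` / `iet_deficit_bound`).  [folklore; context: KozmaNitzan2024, Questions 8–9 (§5.5 p. 36)] -/
theorem iet_graph_of_indicator_levels {ι V : Type*} (ends : ι → Sym2 V) (E : Finset ι) (u b : V) (𝒱 : Finset ι → Prop)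
    (H01 : ∀ (h k ha hb ka kb : Set V → ℝ), Monotone h → Monotone k → Monotone ha → Monotone hb → Monotone ka → Monotone kb →
      (∀ S, h S = 0 ∨ h S = 1) → (∀ S, k S = 0 ∨ k S = 1) → (∀ S, ha S = 0 ∨ ha S = 1) → (∀ S, hb S = 0 ∨ hb S = 1) →
      (∀ S, ka S = 0 ∨ ka S = 1) → (∀ S, kb S = 0 ∨ kb S = 1) →
      (∀ S, ha S ≤ h S) → (∀ S, hb S ≤ h S) → (∀ S, ka S ≤ k S) → (∀ S, kb S ≤ k S) →
      0 ≤ (∑ ω ∈ E.powerset, if 𝒱 ω ∧ b ∈ openCluster (ends '' (↑ω : Set ι)) u ∧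
              b ∉ openCluster (ends '' (↑(E \ ω) : Set ι)) u then
            h (openCluster (ends '' (↑ω : Set ι)) u) *
              k (openCluster (ends '' (↑ω : Set ι)) u) else 0)
        + ∑ ω ∈ E.powerset, if 𝒱 ω ∧ b ∈ openCluster (ends '' (↑(E \ ω) : Set ι)) u ∧
              b ∉ openCluster (ends '' (↑ω : Set ι)) u then
            (ha (openCluster (ends '' (↑ω : Set ι)) u) -
                hb (openCluster (ends '' (↑(E \ ω) : Set ι)) u)) *
              (ka (openCluster (ends '' (↑ω : Set ι)) u) -
                kb (openCluster (ends '' (↑(E \ ω) : Set ι)) u)) else 0)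
    (h k ha hb ka kb : Set V → ℝ) (mh : Monotone h) (mk : Monotone k)
    (mha : Monotone ha) (mhb : Monotone hb) (mka : Monotone ka) (mkb : Monotone kb)
    (ha0 : ∀ S, 0 ≤ ha S) (hah : ∀ S, ha S ≤ h S) (hb0 : ∀ S, 0 ≤ hb S) (hbh : ∀ S, hb S ≤ h S)
    (ka0 : ∀ S, 0 ≤ ka S) (kak : ∀ S, ka S ≤ k S) (kb0 : ∀ S, 0 ≤ kb S) (kbk : ∀ S, kb S ≤ k S) :
    0 ≤ (∑ ω ∈ E.powerset, if 𝒱 ω ∧ b ∈ openCluster (ends '' (↑ω : Set ι)) u ∧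
            b ∉ openCluster (ends '' (↑(E \ ω) : Set ι)) u then
          h (openCluster (ends '' (↑ω : Set ι)) u) *
            k (openCluster (ends '' (↑ω : Set ι)) u) else 0)
      + ∑ ω ∈ E.powerset, if 𝒱 ω ∧ b ∈ openCluster (ends '' (↑(E \ ω) : Set ι)) u ∧
            b ∉ openCluster (ends '' (↑ω : Set ι)) u then
          (ha (openCluster (ends '' (↑ω : Set ι)) u) -
              hb (openCluster (ends '' (↑(E \ ω) : Set ι)) u)) *
            (ka (openCluster (ends '' (↑ω : Set ι)) u) -
              kb (openCluster (ends '' (↑(E \ ω) : Set ι)) u)) else 0 := by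
  classical
  exact iet_of_indicator_levels E
    (fun ω => 𝒱 ω ∧ b ∈ openCluster (ends '' (↑ω : Set ι)) u ∧
      b ∉ openCluster (ends '' (↑(E \ ω) : Set ι)) u)
    (fun ω => 𝒱 ω ∧ b ∈ openCluster (ends '' (↑(E \ ω) : Set ι)) u ∧
      b ∉ openCluster (ends '' (↑ω : Set ι)) u)
    (fun ω => openCluster (ends '' (↑ω : Set ι)) u)
    (fun ω => openCluster (ends '' (↑(E \ ω) : Set ι)) u)
    H01 h k ha hb ka kb mh mk mha mhb mka mkb ha0 hah hb0 hbh ka0 kak kb0 kbk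

/-- **The 0/1 form is a count.**  For `{0,1}`-valued levels the IET form dominates the Hall count of the memos:
  `Σ_{RD} h(X)k(X) + Σ_{DD} (hᵃX − hᵇY)(kᵃX − kᵇY) ≥ #S + #P₁ − #bad₁ − #bad₂`
with `S = RD ∧ h(X) = k(X) = 1`, `P₁ = DD ∧ hᵃX = kᵃX = 1 ∧ hᵇY = kᵇY = 0`, `bad₁ = DD ∧ hᵃX = kᵇY = 1 ∧ hᵇY = kᵃX = 0`, `bad₂ = DD ∧ hᵇY = kᵃX = 1 ∧ hᵃX = kᵇY = 0`
(the `P₂` squares are dropped).  Pointwise case analysis.  With `iet_of_indicator_levels` / `iet_graph_of_indicator_levels` this turns a counting theorem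
'`#bad₁(𝒱) + #bad₂(𝒱) ≤ #S(𝒱) + #P₁(𝒱)` for all 0/1 level systems' into the real-level IET. [folklore] -/
theorem iet01_ge_count {ι V : Type*} [DecidableEq ι] (E : Finset ι) (RD DD : Finset ι → Prop) [DecidablePred RD] [DecidablePred DD]
    (X Y : Finset ι → Set V) (h k ha hb ka kb : Set V → ℝ)
    (h01 : ∀ S, h S = 0 ∨ h S = 1) (k01 : ∀ S, k S = 0 ∨ k S = 1) (ha01 : ∀ S, ha S = 0 ∨ ha S = 1) (hb01 : ∀ S, hb S = 0 ∨ hb S = 1)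
    (ka01 : ∀ S, ka S = 0 ∨ ka S = 1) (kb01 : ∀ S, kb S = 0 ∨ kb S = 1) :
    (∑ ω ∈ E.powerset, if RD ω ∧ h (X ω) = 1 ∧ k (X ω) = 1 then (1 : ℝ) else 0)
      + (∑ ω ∈ E.powerset, if DD ω ∧ ha (X ω) = 1 ∧ ka (X ω) = 1 ∧ hb (Y ω) = 0 ∧ kb (Y ω) = 0 then (1 : ℝ) else 0)
      - (∑ ω ∈ E.powerset, if DD ω ∧ ha (X ω) = 1 ∧ kb (Y ω) = 1 ∧ hb (Y ω) = 0 ∧ ka (X ω) = 0 then (1 : ℝ) else 0)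
      - (∑ ω ∈ E.powerset, if DD ω ∧ hb (Y ω) = 1 ∧ ka (X ω) = 1 ∧ ha (X ω) = 0 ∧ kb (Y ω) = 0 then (1 : ℝ) else 0)
    ≤ (∑ ω ∈ E.powerset, if RD ω then h (X ω) * k (X ω) else 0)
      + ∑ ω ∈ E.powerset, if DD ω then (ha (X ω) - hb (Y ω)) * (ka (X ω) - kb (Y ω)) else 0 := by
  classical
  rw [← Finset.sum_add_distrib, ← Finset.sum_sub_distrib, ← Finset.sum_sub_distrib, ← Finset.sum_add_distrib]
  apply Finset.sum_le_sum
  intro ω _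
  have eR : (if RD ω ∧ h (X ω) = 1 ∧ k (X ω) = 1 then (1 : ℝ) else 0) ≤ (if RD ω then h (X ω) * k (X ω) else 0) := by
    by_cases hR : RD ω
    · rcases h01 (X ω) with e1 | e1 <;> rcases k01 (X ω) with e2 | e2 <;> simp [hR, e1, e2]
    · simp [hR]
  have eD : (if DD ω ∧ ha (X ω) = 1 ∧ ka (X ω) = 1 ∧ hb (Y ω) = 0 ∧ kb (Y ω) = 0 then (1 : ℝ) else 0)
      - (if DD ω ∧ ha (X ω) = 1 ∧ kb (Y ω) = 1 ∧ hb (Y ω) = 0 ∧ ka (X ω) = 0 then (1 : ℝ) else 0)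
      - (if DD ω ∧ hb (Y ω) = 1 ∧ ka (X ω) = 1 ∧ ha (X ω) = 0 ∧ kb (Y ω) = 0 then (1 : ℝ) else 0)
      ≤ (if DD ω then (ha (X ω) - hb (Y ω)) * (ka (X ω) - kb (Y ω)) else 0) := by
    by_cases hD : DD ω
    · rcases ha01 (X ω) with e1 | e1 <;> rcases hb01 (Y ω) with e2 | e2 <;> rcases ka01 (X ω) with e3 | e3 <;>
        rcases kb01 (Y ω) with e4 | e4 <;> simp [hD, e1, e2, e3, e4]
    · simp [hD]
  linarith

end Coefficientwise

end Summit.CriticalPhenomena.PercolationContinuityZ3.Theorems
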